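import Summits.BirchSwinnertonDyer.BirchSwinnertonDyer.Theorems.ManinLocalTwoThreeManinOddAtFourDyadicTwistConductor
import Summits.BirchSwinnertonDyer.BirchSwinnertonDyer.Theorems.ManinLocalTwoThreeManinOddAtFourEtaTwo
import Literature.NumberTheory.EllipticCurves.ManinConstantQuadraticTwistAtTwoOrdinaryProofs
import HarnessLib

/-!
# Route `ManinLocalTwoThree` (cell `bsd-f2-manin`): transport of `p ∤ c` down EVERY dyadic semistable untwist
# (Stevens' `η = 1` AND `η = 2`), for any prime `p` — tool for the twist-minimal cores of C2/C3

For `W` globally minimal with a lattice-optimal `X₀(N)`-datum `D`, `4 ∣ N`, and `W ∼ W' ⊗ ℚ(√d)` with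
`d ∈ {−1, 2, −2}`, `W'` globally minimal and SEMISTABLE at `2` (`4 ∤ N(W')`): if every lattice-optimal datum
on the class of `W'` has Manin constant prime to `p`, then `p ∤ D.maninConstant`
(`maninLocalTwoThree_not_dvd_maninConstant_of_dyadicUntwist_semistable`, granted only modularity `hnf`).
The divisibility `c(D) ∣ c(D')` behind it is assembled from the tree in the two Stevens cases:
* `η = 1` (`d = −1`, or `W'` multiplicative at `2`, or `a₂(W')` odd): the `Γ₀` twist step
  `maninConstant_dvd_of_charTwist_gamma0` with the lattice identity
  `neronLattice_quadraticTwist_two_of_etaOne` (Stevens (5.2) at `2`, Pal/Connell minimal twist);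
* `η = 2` (`d = ±2`, `W'` good at `2` with `a₂(W')` even): seat p3's E-an-1 route — K1
  `half_gaussSum_mul_mem_periodLattice_of_heckeTwo`, K2 `isGloballyMinimal_quadraticTwist_two_of_even_LFunction_two`,
  engine `ManinAdditive.maninConstant_dvd_mul_of_twistStep` (`r = 1`) — run to `c(D) ∣ c(D')` instead of
  `2 ∤ c` (body of `not_two_dvd_maninConstant_of_twist_etaTwo_of_char` verbatim up to the last step).
Conductor side conditions by the landed `stub_dyadicTwistConductor`. Used by the sequel
`ManinLocalTwoThreeManinPrimeToThreeAtNineFullUntwist.lean` (C3 ⟸ its core with NO single-prime semistable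
untwist at all). Nothing here proves BSD or Manin's conjecture. Seat bsd-line-manin23-p2.

References: [Stevens1989] Lemmas (5.2), (5.4), (5.6)–(5.7); [Pal2012] Prop. 2.4, Lemma 3.1; [Cesnavicius2018]
Thm. 1.2; [MazurTateTeitelbaum1986Invent] §I.4.
-/

set_option autoImplicit false
set_option linter.dupNamespace false

noncomputable section

open scoped MatrixGroups ModularForm Classical NumberField

namespace Summit.BirchSwinnertonDyer.BirchSwinnertonDyer.Theorems

open CongruenceSubgroup WeierstrassCurve IsDedekindDomain IsDedekindDomain.HeightOneSpectrum
  Rat.HeightOneSpectrum Literature.NumberTheory.Automorphic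
  Literature.NumberTheory.EllipticCurves Literature.NumberTheory.EllipticCurves.ModularForms
  Summit.BirchSwinnertonDyer.Rank1Residual.ManinAdditive

/-! ## §1 `η = 1` (all three sub-cases) -/

/-- Dyadic transport, `η = 1`, generic character: as the landed
`maninLocalTwoThree_not_dvd_maninConstant_of_dyadicUntwist_of_char` but with Stevens' clause widened to
`d = −1 ∨ 2 ∣ N(W') ∨ a₂(W') odd` (lattice identity `neronLattice_quadraticTwist_two_of_etaOne`).
[cite: Stevens1989, Lemmas (5.2), (5.4)] [cite: Pal2012, Prop. 2.4, Lemma 3.1] -/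
theorem maninLocalTwoThree_not_dvd_maninConstant_of_dyadicUntwist_etaOne_of_char
    (hnf : exists_isNewformOf)
    {W : WeierstrassCurve ℚ} [W.IsElliptic] [W.IsGloballyMinimal] {N : ℕ} [NeZero N]
    (D : ModularParametrizationData W N)
    (hopt : ∀ z ∈ D.L.lattice, ∃ w ∈ periodLattice D.f, z = D.c * w)
    {W' : WeierstrassCurve ℚ} [W'.IsElliptic] [W'.IsGloballyMinimal]
    {d : ℤ} (hd : d = -1 ∨ d = 2 ∨ d = -2)
    {m : ℕ} [NeZero m] {χ : DirichletCharacter ℂ m} (hχq : χ.IsQuadratic) (hχp : χ.IsPrimitive)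
    (hG : gaussSum χ (ZMod.stdAddChar (N := m)) ^ 2 = ((4 * d : ℤ) : ℂ))
    (hχodd : ∀ n : ℕ, ¬ 2 ∣ n →
      (((W'.quadraticTwist (d : ℚ)).LFunction n : ℤ) : ℂ) = χ n * ((W'.LFunction n : ℤ) : ℂ))
    (hχeven : ∀ n : ℕ, 2 ∣ n → χ n = 0)
    (htw : IsIsogenous W (W'.quadraticTwist (d : ℚ)))
    (hN'N : W'.conductorNorm ℤ ∣ N) (hmN : m ^ 2 ∣ N)
    (h4N' : ¬ 2 ^ 2 ∣ W'.conductorNorm ℤ) (hη : d = -1 ∨ 2 ∣ W'.conductorNorm ℤ ∨ Odd (W'.LFunction 2))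
    (hadd : ¬ W.HasGoodReductionAtPrime 2 ∧ ¬ W.HasMultiplicativeReductionAtPrime 2) {p : ℤ}
    (hp : ∀ (W₁ : WeierstrassCurve ℚ) [W₁.IsElliptic] [W₁.IsGloballyMinimal] {N₁ : ℕ} [NeZero N₁]
      (D₁ : ModularParametrizationData W₁ N₁), IsIsogenous W' W₁ →
      (∀ z ∈ D₁.L.lattice, ∃ w ∈ periodLattice D₁.f, z = D₁.c * w) → ¬ p ∣ D₁.maninConstant) :
    ¬ p ∣ D.maninConstant := by
  haveI : Fact (Nat.Prime 2) := ⟨Nat.prime_two⟩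
  have hdZ : d ≠ 0 := by rcases hd with rfl | rfl | rfl <;> norm_num
  have hd0 : (d : ℚ) ≠ 0 := by exact_mod_cast hdZ
  haveI : (W'.quadraticTwist (d : ℚ)).IsElliptic := W'.isElliptic_quadraticTwist hd0
  haveI : NeZero (W'.conductorNorm ℤ) := ⟨(conductorNorm_pos_holds W').ne'⟩
  obtain ⟨f', hf'⟩ := hnf W'
  obtain ⟨W₁', hE₁', hM₁', D', hD'f, hiso', hmin⟩ :=
    exists_optimal_modularParametrizationData_of_isNewformOf' (W'.conductorNorm ℤ) W' rfl hf'
  haveI := hE₁'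
  haveI := hM₁'
  have hopt' : ∀ z ∈ D'.L.lattice, ∃ w ∈ periodLattice D'.f, z = D'.c * w :=
    D'.latticeEq_of_forall_modularDegree_le fun W₂ _ D₂ h2 ↦ hmin W₂ D₂ (h2.trans hD'f)
  have hN'₁ : W'.conductorNorm ℤ = W₁'.conductorNorm ℤ :=
    IsNewformOf.level_eq_conductorNorm_of_exists_isNewformOf hnf D'.isNewformOf
  have hsemi : W₁'.HasGoodReductionAtPrime 2 ∨ W₁'.HasMultiplicativeReductionAtPrime 2 :=
    hasGoodReductionAtPrime_or_hasMultiplicativeReductionAtPrime_of_not_sq_dvd_conductorNorm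
      (by rw [← hN'₁]; exact h4N')
  have hη₁ : d = -1 ∨ W₁'.HasMultiplicativeReductionAtPrime 2 ∨ Odd (W₁'.LFunction 2) := by
    rcases hη with h | h2N | hodd
    · exact Or.inl h
    · right; left
      rcases hsemi with hg | hm'
      · exfalso
        rw [hN'₁] at h2N
        exact ((dvd_conductorNorm_iff_not_hasGoodReductionAtPrime W₁' 2).mp h2N) hg
      · exact hm'
    · right; right
      rwa [LFunction_eq_of_isIsogenous_holds W' W₁' hiso'] at hodd
  haveI : (W₁'.quadraticTwist (d : ℚ)).IsElliptic := W₁'.isElliptic_quadraticTwist hd0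
  obtain ⟨vC, hvC⟩ := hasGlobalMinimalModel_rat_holds (W₁'.quadraticTwist (d : ℚ))
  haveI := hvC
  haveI : ((vC • W₁'.quadraticTwist (d : ℚ)).baseChange ℂ).IsElliptic := by
    rw [WeierstrassCurve.baseChange]; infer_instance
  obtain ⟨LC, hC⟩ := exists_isNeronLatticeOf_holds ((vC • W₁'.quadraticTwist (d : ℚ)).baseChange ℂ)
  have hLC : ∀ z : ℂ, z ∈ LC.lattice ↔ gaussSum χ (ZMod.stdAddChar (N := m)) * z ∈ D'.L.lattice :=
    fun z ↦ neronLattice_quadraticTwist_two_of_etaOne D'.isNeronLattice hd hsemi hη₁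
      (vC • W₁'.quadraticTwist (d : ℚ)) ⟨vC, rfl⟩ hC hG z
  have hLtw : W.LFunction = (W'.quadraticTwist (d : ℚ)).LFunction :=
    LFunction_eq_of_isIsogenous_holds _ _ htw
  have hf : ∀ n : ℕ, cuspCoeff D.f n = χ n * cuspCoeff D'.f n := by
    intro n
    rw [D.isNewformOf.2 n, hD'f, hf'.2 n]
    by_cases h2n : 2 ∣ n
    · have h0 : W.LFunction n = 0 :=
        W.LFunction_apply_eq_zero_of_not_good_of_not_mult 2 hadd.1 hadd.2 h2n
      rw [h0, hχeven n h2n]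
      simp
    · have hLn' : W.LFunction n = (W'.quadraticTwist (d : ℚ)).LFunction n := by rw [hLtw]
      rw [hLn', hχodd n h2n]
  have hdvd : D.c ∣ D'.c := maninConstant_dvd_of_charTwist_gamma0 D' D hopt hχq hχp hN'N hmN hf hC hLC
  have hD' : ¬ p ∣ D'.maninConstant := hp W₁' D' hiso' hopt'
  exact fun h ↦ hD' (h.trans hdvd)

/-! ## §2 `η = 2` -/

/-- Dyadic transport, `η = 2`, generic character mod `8` (`d = ±2`, `W'` good at `2` with `a₂(W')` even):
seat p3's `not_two_dvd_maninConstant_of_twist_etaTwo_of_char` run to the divisibility `c(D) ∣ c(D')`.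
[cite: Stevens1989, Lemmas (5.4), (5.6)–(5.7)] [cite: Pal2012, Lemma 3.1] -/
theorem maninLocalTwoThree_not_dvd_maninConstant_of_dyadicUntwist_etaTwo_of_char
    (hnf : exists_isNewformOf)
    {W : WeierstrassCurve ℚ} [W.IsElliptic] [W.IsGloballyMinimal] {N : ℕ} [NeZero N]
    (D : ModularParametrizationData W N)
    (hopt : ∀ z ∈ D.L.lattice, ∃ w ∈ periodLattice D.f, z = D.c * w)
    {W' : WeierstrassCurve ℚ} [W'.IsElliptic] [W'.IsGloballyMinimal]
    {d : ℤ} (hd : d = 2 ∨ d = -2)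
    {χ : DirichletCharacter ℂ 8} (hχq : χ.IsQuadratic) (hχp : χ.IsPrimitive)
    (hG : gaussSum χ (ZMod.stdAddChar (N := 8)) ^ 2 = ((4 * d : ℤ) : ℂ))
    {ε : ℤ} (hε : ε = 1 ∨ ε = -1)
    (hχsum : ∀ F : ZMod 8 → ℂ, ∑ u : ZMod 8, χ u * F u = F 1 + ε * F 3 - F 5 - ε * F 7)
    (hχodd : ∀ n : ℕ, ¬ 2 ∣ n →
      (((W'.quadraticTwist (d : ℚ)).LFunction n : ℤ) : ℂ) = χ n * ((W'.LFunction n : ℤ) : ℂ))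
    (hχeven : ∀ n : ℕ, 2 ∣ n → χ n = 0)
    (htw : IsIsogenous W (W'.quadraticTwist (d : ℚ)))
    (hN'N : W'.conductorNorm ℤ ∣ N) (hmN : 8 ^ 2 ∣ N)
    (hgood : W'.HasGoodReductionAtPrime 2) (hss : Even (W'.LFunction 2))
    (hadd : ¬ W.HasGoodReductionAtPrime 2 ∧ ¬ W.HasMultiplicativeReductionAtPrime 2) {p : ℤ}
    (hp : ∀ (W₁ : WeierstrassCurve ℚ) [W₁.IsElliptic] [W₁.IsGloballyMinimal] {N₁ : ℕ} [NeZero N₁]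
      (D₁ : ModularParametrizationData W₁ N₁), IsIsogenous W' W₁ →
      (∀ z ∈ D₁.L.lattice, ∃ w ∈ periodLattice D₁.f, z = D₁.c * w) → ¬ p ∣ D₁.maninConstant) :
    ¬ p ∣ D.maninConstant := by
  haveI : Fact (Nat.Prime 2) := ⟨Nat.prime_two⟩
  have hdZ : d ≠ 0 := by rcases hd with rfl | rfl <;> norm_num
  have hd0 : (d : ℚ) ≠ 0 := by exact_mod_cast hdZ
  haveI : (W'.quadraticTwist (d : ℚ)).IsElliptic := W'.isElliptic_quadraticTwist hd0
  haveI : NeZero (W'.conductorNorm ℤ) := ⟨(conductorNorm_pos_holds W').ne'⟩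
  obtain ⟨f', hf'⟩ := hnf W'
  obtain ⟨W₁', hE₁', hM₁', D', hD'f, hiso₁, hmin⟩ :=
    exists_optimal_modularParametrizationData_of_isNewformOf' (W'.conductorNorm ℤ) W' rfl hf'
  haveI := hE₁'
  haveI := hM₁'
  have hopt' : ∀ z ∈ D'.L.lattice, ∃ w ∈ periodLattice D'.f, z = D'.c * w :=
    D'.latticeEq_of_forall_modularDegree_le fun W₂ _ D₂ h2 ↦ hmin W₂ D₂ (h2.trans hD'f)
  have hN'₁ : W'.conductorNorm ℤ = W₁'.conductorNorm ℤ :=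
    IsNewformOf.level_eq_conductorNorm_of_exists_isNewformOf hnf D'.isNewformOf
  have h2N' : ¬ 2 ∣ W'.conductorNorm ℤ :=
    not_two_dvd_conductorNorm_of_hasGoodReductionAtPrime_two W' hgood
  have hgood₁ : W₁'.HasGoodReductionAtPrime 2 :=
    hasGoodReductionAtPrime_two_of_not_two_dvd_conductorNorm W₁' (by rw [← hN'₁]; exact h2N')
  have hss₁ : Even (W₁'.LFunction 2) := by
    rwa [LFunction_eq_of_isIsogenous_holds W' W₁' hiso₁] at hss
  -- K2
  haveI : (W₁'.quadraticTwist (d : ℚ)).IsElliptic := W₁'.isElliptic_quadraticTwist hd0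
  haveI : (W₁'.quadraticTwist (d : ℚ)).IsGloballyMinimal :=
    isGloballyMinimal_quadraticTwist_two_of_even_LFunction_two W₁' hd hgood₁ hss₁
  have hG0 : gaussSum χ (ZMod.stdAddChar (N := 8)) ≠ 0 :=
    gaussSum_stdAddChar_ne_zero_of_isPrimitive hχp
  have hs0 : gaussSum χ (ZMod.stdAddChar (N := 8)) / 2 ≠ 0 := div_ne_zero hG0 two_ne_zero
  have hs2 : (gaussSum χ (ZMod.stdAddChar (N := 8)) / 2) ^ 2 = ((d : ℚ) : ℂ) := by
    rw [div_pow, hG]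
    push_cast
    ring
  have hC : IsNeronLatticeOf ((W₁'.quadraticTwist (d : ℚ)).baseChange ℂ)
      (D'.L.mulLeft (gaussSum χ (ZMod.stdAddChar (N := 8)) / 2)⁻¹ (inv_ne_zero hs0)) :=
    isNeronLatticeOf_quadraticTwist_of_sq_eq (d : ℚ) D'.isNeronLattice hs0 hs2
  have hLC : ∀ z : ℂ, gaussSum χ (ZMod.stdAddChar (N := 8)) / 2 * z ∈ D'.L.lattice →
      ((1 : ℤ) : ℂ) * z ∈
        (D'.L.mulLeft (gaussSum χ (ZMod.stdAddChar (N := 8)) / 2)⁻¹ (inv_ne_zero hs0)).lattice := by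
    intro z hz
    rw [PeriodPair.mem_mulLeft_lattice, inv_inv, Int.cast_one, one_mul]
    exact hz
  -- the newform of `𝒜` is the `χ`-twist of that of `𝒜'`
  have hLtw : W.LFunction = (W'.quadraticTwist (d : ℚ)).LFunction :=
    LFunction_eq_of_isIsogenous_holds _ _ htw
  have hf : ∀ n : ℕ, cuspCoeff D.f n = χ n * cuspCoeff D'.f n := by
    intro n
    rw [D.isNewformOf.2 n, hD'f, hf'.2 n]
    by_cases h2n : 2 ∣ n
    · have h0 : W.LFunction n = 0 :=
        W.LFunction_apply_eq_zero_of_not_good_of_not_mult 2 hadd.1 hadd.2 h2n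
      rw [h0, hχeven n h2n]
      simp
    · have hLn' : W.LFunction n = (W'.quadraticTwist (d : ℚ)).LFunction n := by rw [hLtw]
      rw [hLn', hχodd n h2n]
  -- S1 + K1
  obtain ⟨k, hk⟩ := hss₁
  have hT₂ : ∀ r : ℚ, (2 * k : ℂ) * modularSymbol D'.f r =
      ∑ j : Fin 2, modularSymbol D'.f ((r + j) / 2) + modularSymbol D'.f (2 * r) := by
    intro r
    have h := cuspCoeff_mul_modularSymbol 2 D'.isNewformOf.1 Nat.prime_two h2N' r
    rw [D'.isNewformOf.2 2, hk] at h
    push_cast at h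
    rw [show (k : ℂ) + k = 2 * k by ring] at h
    exact h
  have hstep : ∀ w ∈ periodLattice (charTwist N hN'N hmN hχq D'.f),
      gaussSum χ (ZMod.stdAddChar (N := 8)) / 2 * w ∈ periodLattice D'.f :=
    fun w hw ↦ half_gaussSum_mul_mem_periodLattice_of_heckeTwo N hN'N hmN hχq hχp hε hχsum D'.f
      h2N' k hT₂ hw
  -- the engine, `r = 1`
  have hdvd : D.c ∣ 1 * D'.c :=
    maninConstant_dvd_mul_of_twistStep D' D hopt hχq hχp hN'N hmN hf
      (gaussSum χ (ZMod.stdAddChar (N := 8)) / 2) hstep hC 1 hLC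
  rw [one_mul] at hdvd
  have hD' : ¬ p ∣ D'.maninConstant := hp W₁' D' hiso₁ hopt'
  exact fun h ↦ hD' (h.trans hdvd)

/-! ## §3 Every dyadic semistable untwist -/

/-- **Transport of `p ∤ c` down ANY dyadic semistable untwist** (granted modularity): `W` globally minimal
with a lattice-optimal `X₀(N)`-datum `D`, `4 ∣ N`; `W ∼ W' ⊗ ℚ(√d)`, `d ∈ {−1, 2, −2}`, `W'` globally
minimal with `4 ∤ N(W')`. If every lattice-optimal datum on the class of `W'` has Manin constant prime to
`p`, then so has `D`. Dispatch: Stevens' `η = 1` (`d = −1`, or `2 ∣ N(W')`, or `a₂(W')` odd; §1 with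
`χ₋₄ / χ₈ / χ₋₈`) or `η = 2` (`d = ±2`, `W'` good at `2`, `a₂` even; §2 with `χ₈ / χ₋₈`).
[cite: Stevens1989, Lemmas (5.2), (5.4), (5.6)–(5.7)] [cite: Pal2012, Prop. 2.4, Lemma 3.1] -/
theorem maninLocalTwoThree_not_dvd_maninConstant_of_dyadicUntwist_semistable
    (hnf : exists_isNewformOf)
    {W : WeierstrassCurve ℚ} [W.IsElliptic] [W.IsGloballyMinimal] {N : ℕ} [NeZero N]
    (D : ModularParametrizationData W N)
    (hopt : ∀ z ∈ D.L.lattice, ∃ w ∈ periodLattice D.f, z = D.c * w) (h4 : 2 ^ 2 ∣ N)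
    {W' : WeierstrassCurve ℚ} [W'.IsElliptic] [W'.IsGloballyMinimal]
    {d : ℤ} (hd : d = -1 ∨ d = 2 ∨ d = -2) (htw : IsIsogenous W (W'.quadraticTwist (d : ℚ)))
    (h4N' : ¬ 2 ^ 2 ∣ W'.conductorNorm ℤ) {p : ℤ}
    (hp : ∀ (W₁ : WeierstrassCurve ℚ) [W₁.IsElliptic] [W₁.IsGloballyMinimal] {N₁ : ℕ} [NeZero N₁]
      (D₁ : ModularParametrizationData W₁ N₁), IsIsogenous W' W₁ →
      (∀ z ∈ D₁.L.lattice, ∃ w ∈ periodLattice D₁.f, z = D₁.c * w) → ¬ p ∣ D₁.maninConstant) :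
    ¬ p ∣ D.maninConstant := by
  haveI : Fact (Nat.Prime 2) := ⟨Nat.prime_two⟩
  have hN : N = W.conductorNorm ℤ :=
    IsNewformOf.level_eq_conductorNorm_of_exists_isNewformOf hnf D.isNewformOf
  have hadd : ¬ W.HasGoodReductionAtPrime 2 ∧ ¬ W.HasMultiplicativeReductionAtPrime 2 :=
    Summit.BirchSwinnertonDyer.Rank1Residual.ManinAdditive.not_good_and_not_mult_of_sq_dvd_conductorNorm
      W (hN ▸ h4)
  obtain ⟨hN'N, hmN⟩ := stub_dyadicTwistConductor hnf hd htw h4N' hadd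
  rw [← hN] at hN'N hmN
  by_cases hη : d = -1 ∨ 2 ∣ W'.conductorNorm ℤ ∨ Odd (W'.LFunction 2)
  · rcases hd with rfl | rfl | rfl
    · refine maninLocalTwoThree_not_dvd_maninConstant_of_dyadicUntwist_etaOne_of_char hnf D hopt (d := -1)
        (Or.inl rfl) isQuadratic_χ₄_ringHomComp isPrimitive_χ₄_ringHomComp
        (by rw [gaussSum_χ₄_ringHomComp_sq]; norm_num) (fun n hn ↦ ?_) (fun n hn ↦ ?_) htw hN'N
        (by simpa using hmN) h4N' hη hadd hp
      · rw [show ((-1 : ℤ) : ℚ) = -1 by norm_num, W'.LFunction_quadraticTwist_neg_one_apply_of_odd hn,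
          Int.cast_mul, χ₄_ringHomComp_apply_natCast]
      · rw [χ₄_ringHomComp_apply_natCast, ZMod.χ₄_nat_eq_if_mod_four, if_pos (Nat.mod_eq_zero_of_dvd hn)]
        simp
    · refine maninLocalTwoThree_not_dvd_maninConstant_of_dyadicUntwist_etaOne_of_char hnf D hopt (d := 2)
        (Or.inr (Or.inl rfl)) isQuadratic_χ₈_ringHomComp isPrimitive_χ₈_ringHomComp
        (by rw [gaussSum_χ₈_ringHomComp_sq]; norm_num) (fun n hn ↦ ?_) (fun n hn ↦ ?_) htw hN'N
        (by simpa using hmN) h4N' hη hadd hp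
      · rw [show ((2 : ℤ) : ℚ) = 2 by norm_num, W'.LFunction_quadraticTwist_two_apply_of_odd hn,
          Int.cast_mul, χ₈_ringHomComp_apply_natCast]
      · rw [χ₈_ringHomComp_apply_natCast, ZMod.χ₈_nat_eq_if_mod_eight,
          if_pos (Nat.mod_eq_zero_of_dvd hn)]
        simp
    · refine maninLocalTwoThree_not_dvd_maninConstant_of_dyadicUntwist_etaOne_of_char hnf D hopt (d := -2)
        (Or.inr (Or.inr rfl)) isQuadratic_χ₈'_ringHomComp isPrimitive_χ₈'_ringHomComp
        (by rw [gaussSum_χ₈'_ringHomComp_sq]; norm_num) (fun n hn ↦ ?_) (fun n hn ↦ ?_) htw hN'N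
        (by simpa using hmN) h4N' hη hadd hp
      · rw [show ((-2 : ℤ) : ℚ) = -2 by norm_num, W'.LFunction_quadraticTwist_neg_two_apply_of_odd hn,
          Int.cast_mul, χ₈'_ringHomComp_apply_natCast]
      · rw [χ₈'_ringHomComp_apply_natCast, ZMod.χ₈'_nat_eq_if_mod_eight,
          if_pos (Nat.mod_eq_zero_of_dvd hn)]
        simp
  · -- `η = 2`: `d = ±2`, `W'` good at `2`, `a₂(W')` even
    push Not at hη
    obtain ⟨hd1, h2N', hodd⟩ := hη
    have hgood : W'.HasGoodReductionAtPrime 2 :=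
      hasGoodReductionAtPrime_two_of_not_two_dvd_conductorNorm W' h2N'
    have hss : Even (W'.LFunction 2) := Int.not_odd_iff_even.mp hodd
    have hd' : d = 2 ∨ d = -2 := by
      rcases hd with h | h | h
      · exact absurd h hd1
      · exact Or.inl h
      · exact Or.inr h
    have hmN' : 8 ^ 2 ∣ N := by
      have habs : d.natAbs = 2 := by rcases hd' with rfl | rfl <;> rfl
      rw [habs] at hmN
      simpa using hmN
    rcases hd' with rfl | rfl
    · refine maninLocalTwoThree_not_dvd_maninConstant_of_dyadicUntwist_etaTwo_of_char hnf D hopt (Or.inl rfl)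
        isQuadratic_χ₈_ringHomComp isPrimitive_χ₈_ringHomComp
        (by rw [gaussSum_χ₈_ringHomComp_sq]; norm_num) (ε := -1) (Or.inr rfl) sum_χ₈_shape
        (fun n hn ↦ ?_) (fun n hn ↦ ?_) htw hN'N hmN' hgood hss hadd hp
      · rw [show ((2 : ℤ) : ℚ) = 2 by norm_num, W'.LFunction_quadraticTwist_two_apply_of_odd hn,
          Int.cast_mul, χ₈_ringHomComp_apply_natCast]
      · rw [χ₈_ringHomComp_apply_natCast, ZMod.χ₈_nat_eq_if_mod_eight,
          if_pos (Nat.mod_eq_zero_of_dvd hn)]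
        simp
    · refine maninLocalTwoThree_not_dvd_maninConstant_of_dyadicUntwist_etaTwo_of_char hnf D hopt (Or.inr rfl)
        isQuadratic_χ₈'_ringHomComp isPrimitive_χ₈'_ringHomComp
        (by rw [gaussSum_χ₈'_ringHomComp_sq]; norm_num) (ε := 1) (Or.inl rfl) sum_χ₈'_shape
        (fun n hn ↦ ?_) (fun n hn ↦ ?_) htw hN'N hmN' hgood hss hadd hp
      · rw [show ((-2 : ℤ) : ℚ) = -2 by norm_num, W'.LFunction_quadraticTwist_neg_two_apply_of_odd hn,
          Int.cast_mul, χ₈'_ringHomComp_apply_natCast]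
      · rw [χ₈'_ringHomComp_apply_natCast, ZMod.χ₈'_nat_eq_if_mod_eight,
          if_pos (Nat.mod_eq_zero_of_dvd hn)]
        simp

end Summit.BirchSwinnertonDyer.BirchSwinnertonDyer.Theorems

end
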